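import Summits.Parity.GeneralizedHardyLittlewood.Theorems.PrimeLevelFamEdgeMomentsBeyondDiagonalTwoOrderGap
import Summits.Parity.GeneralizedHardyLittlewood.Theorems.PrimeLevelFamEdgeMomentsBeyondDiagonalTwoOrderBoxError
import Summits.Parity.GeneralizedHardyLittlewood.Theorems.PrimeLevelFamEdgeMomentsBeyondDiagonalTwoOrderOffBox
import Summits.Parity.GeneralizedHardyLittlewood.Theorems.PrimeLevelFamEdgeIdeaDeltasPeterssonLayersBands
import HarnessLib

/-!
# Route `PrimeLevelFamEdge`, crux K_A `MomentsBeyondDiagonal` (stmt-Parity-20007), line «petersson_layers» v4: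
# THE IDENTIFICATION AT EVERY `Q` — registered stub `stub_identP : TailNearFar rhoP`, PROVED

`TailNearFar ρ` (deck 21b): on a window beyond the diagonal, for every admissible `P` and every even-or-odd `Q`, the
difference-defined tail IS minus the far layers up to `O(q̂ log⁻³ q̂)`, i.e. (by `tail_add_farLayers`)
`‖Q^h(P,Q)(q̂^{Δ'}) − (diagPart − Σ_{r≤q⁸} layer r)‖ ≤ C q̂ (log q̂)⁻³`. The tree had the `Q = 1` slice (`tailNearFar_atOne`,
p634139). Here, for EVERY real polynomial `Q` (no parity or admissibility needed):
* §1 `norm_gap₂_le`: per order `(i,j)`, `‖GAP_{ij}‖ ≤ G_{ij} ((1+log q̂)(1+2 log q))^{i+j}` (`…TwoOrderGap` §3 +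
  `norm_boxSum₂_le` + `norm_offBoxTsum₂_le`);
* §2 `one_add_log_pow_le_mul_inv_log_cube`: `(1+log x)^d ≤ K_d · x · (log x)⁻³` for `x ≥ e` (polylog ≪ q̂ log⁻³ q̂), and
  `one_add_two_log_le`: `1 + 2 log q ≤ 9 (1 + log q̂)` (`q = 4π² q̂²`, `log 2π ≤ 2`), `exp_one_le_qhat`: `q ≥ 324 ⇒ q̂ ≥ e`;
* §3 `tailNearFar_allQ`: for all real `P, Q`, every cut `ρ ≤ 8` on `(1, 3/2]`: `∃ C ∀ Δ' ∈ (1,3/2] ∀ prime q ≥ 324`,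
  `‖tail − (−far)‖ ≤ C q̂ (log q̂)⁻³` (`…TwoOrderGap` §2, the order sum with `|ℓ^{−(i+j)}| ≤ 1` once `log q̂ ≥ 1`);
* §4 **`stub_identP : TailNearFar rhoP`** — the registered stub of the line, BY NAME (window `(1, 3/2]`, threshold `324`).
What this is NOT: a moment asymptotic (no `HasShape`), nothing about `stub_core`/`stub_rung`/`stub_band` (the wall, open) or
`stub_diag`/`stub_first`/`stub_farP`; K_A is NOT proved; nothing about Landau–Siegel zeros.
-/

noncomputable section

open scoped Real Nat
open Complex Finset Polynomial CongruenceSubgroup MeasureTheory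
open Literature.NumberTheory.EllipticCurves.ModularForms
open Literature.NumberTheory.LFunctions

namespace Summit.Parity.GeneralizedHardyLittlewood.Theorems.MomentsBeyondDiagonal.TwoOrderAFE

open Summit.Parity.GeneralizedHardyLittlewood.Theorems.PrimeLevelFamEdgeIdeaDeltas.PeterssonLayers

/-! ## §1. The per-order gap bound -/

/-- `‖1 + (−1)^{i+j}‖ ≤ 2`. -/
theorem norm_one_add_neg_one_pow_le (k : ℕ) : ‖(1 + (-1 : ℂ) ^ k)‖ ≤ 2 := by
  calc ‖(1 + (-1 : ℂ) ^ k)‖ ≤ ‖(1 : ℂ)‖ + ‖(-1 : ℂ) ^ k‖ := norm_add_le _ _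
    _ = 2 := by rw [norm_pow, norm_neg, norm_one, one_pow]; norm_num

/-- **§1. The gap at orders `(i,j)` is polylogarithmic**: for every real `P` there is `G` such that for all primes `q ≥ 64`
and `0 < Δ' ≤ 3/2` (`M = q̂^{Δ'}`),
`‖Σʰ Λ^{(i)}Λ^{(j)} M_P² − (1+(−1)^{i+j}) q̂ Σ_{box²} (n₁n₂)^{−1/2} W_{ij} Σ_m x x Σ_d [δ − Σ_{r≤q⁸} layerKernel](a,b)‖ ≤ G ((1+log q̂)(1+2 log q))^{i+j}`.
[cite: KowalskiMichelVanderKam2000, (21)–(22) p. 12; KowalskiMichel2000, §2.4.2 p. 312] -/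
theorem norm_gap₂_le (P : ℝ[X]) (i j : ℕ) :
    ∃ G : ℝ, 0 ≤ G ∧ ∀ (q : ℕ) [NeZero q], q.Prime → 64 ≤ q → ∀ Δ' : ℝ, 0 < Δ' → Δ' ≤ 3 / 2 →
      ‖GL2Family.harmonicSum q 2 (fun f ↦ KMV2000.derivLambda q i f * KMV2000.derivLambda q j f *
            KMV2000.mollifierP q P (KMV2000.qhat q ^ Δ') f ^ 2) -
          (1 + (-1 : ℂ) ^ (i + j)) * (KMV2000.qhat q : ℂ) *
            ∑ n₁ ∈ afeBox q, ∑ n₂ ∈ afeBox q,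
              ((((n₁ : ℝ) * n₂) ^ (-(1 / 2 : ℝ)) : ℝ) : ℂ) * KMV2000.afeW (KMV2000.qhat q) i j n₁ n₂ *
              ∑ m₁ ∈ Icc 1 ⌊KMV2000.qhat q ^ Δ'⌋₊, ∑ m₂ ∈ Icc 1 ⌊KMV2000.qhat q ^ Δ'⌋₊,
                (KMV2000.mollifierCoeff P (KMV2000.qhat q ^ Δ') m₁ : ℂ) *
                  (KMV2000.mollifierCoeff P (KMV2000.qhat q ^ Δ') m₂ : ℂ) *
                ∑ d₁ ∈ (Nat.gcd m₁ n₁).divisors, ∑ d₂ ∈ (Nat.gcd m₂ n₂).divisors,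
                  (diagKernel (m₁ * n₁ / d₁ ^ 2) (m₂ * n₂ / d₂ ^ 2) -
                    ∑ r ∈ Icc 1 (q ^ 8), layerKernel q r (m₁ * n₁ / d₁ ^ 2) (m₂ * n₂ / d₂ ^ 2))‖ ≤
        G * ((1 + Real.log (KMV2000.qhat q)) * (1 + 2 * Real.log q)) ^ (i + j) := by
  obtain ⟨A, hA0, hA⟩ := norm_boxSum₂_le P i j
  obtain ⟨A', hA'0, hA'⟩ := norm_offBoxTsum₂_le P i j
  refine ⟨2 * A + A', by positivity, fun q _ hq h64 Δ' h0 h32 ↦ ?_⟩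
  obtain ⟨hM1, hM32, hMq⟩ := mollifierLength_facts h64 h0 h32
  have hqh1 : 1 < KMV2000.qhat q := one_lt_qhat h64
  have hqh0 : 0 < KMV2000.qhat q := zero_lt_one.trans hqh1
  have hq1 : (1 : ℝ) < q := by exact_mod_cast hq.one_lt
  have hsplit := harmonicSum_derivLambda_mul_sq_sub_box_eq hq P hMq i j
    (fun a b ↦ diagKernel a b - ∑ r ∈ Icc 1 (q ^ 8), layerKernel q r a b)
  rw [hsplit]
  have hbox := hA q hq h64 Δ' h0 h32
  have hoff := hA' q hq h64 Δ' h0 h32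
  set L : ℝ := ((1 + Real.log (KMV2000.qhat q)) * (1 + 2 * Real.log q)) ^ (i + j) with hLdef
  have hlq : 0 ≤ Real.log (KMV2000.qhat q) := Real.log_nonneg hqh1.le
  have hlq' : 0 ≤ Real.log (q : ℝ) := Real.log_nonneg hq1.le
  have hL'le : (1 + Real.log (KMV2000.qhat q)) ^ (i + j) ≤ L := by
    rw [hLdef]
    refine pow_le_pow_left₀ (by positivity) ?_ _
    nlinarith
  have he2 := norm_one_add_neg_one_pow_le (i + j)
  calc _ ≤ _ := norm_add_le _ _
    _ ≤ 2 * KMV2000.qhat q * (A * ((1 + Real.log (KMV2000.qhat q)) * (1 + 2 * Real.log q)) ^ (i + j) *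
          (KMV2000.qhat q)⁻¹) + A' * (1 + Real.log (KMV2000.qhat q)) ^ (i + j) := by
        refine add_le_add ?_ hoff
        rw [norm_mul, norm_mul, Complex.norm_real, Real.norm_eq_abs, abs_of_pos hqh0]
        gcongr
    _ = 2 * A * L + A' * (1 + Real.log (KMV2000.qhat q)) ^ (i + j) := by rw [hLdef]; field_simp
    _ ≤ 2 * A * L + A' * L := by gcongr
    _ = (2 * A + A') * L := by ring

/-! ## §2. Polylog versus `q̂ (log q̂)⁻³` -/

/-- `(1 + log x)^d ≤ K_d · x · (log x)⁻³` for `x ≥ e`, with `K_d = (d+4)^{d+3}`. -/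
theorem one_add_log_pow_le_mul_inv_log_cube (d : ℕ) :
    ∃ K : ℝ, 0 ≤ K ∧ ∀ x : ℝ, Real.exp 1 ≤ x → (1 + Real.log x) ^ d ≤ K * x * (Real.log x)⁻¹ ^ 3 := by
  set ε : ℝ := 1 / ((d : ℝ) + 3) with hεdef
  have hε : 0 < ε := by rw [hεdef]; positivity
  refine ⟨(1 + ε⁻¹) ^ (d + 3), by positivity, fun x hx ↦ ?_⟩
  have hx1 : 1 ≤ x := le_trans (by have := Real.add_one_le_exp (1 : ℝ); linarith) hx
  have hx0 : 0 < x := by linarith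
  have hlog1 : 1 ≤ Real.log x := by rwa [Real.le_log_iff_exp_le hx0]
  have hlog0 : 0 < Real.log x := by linarith
  have h := one_add_log_pow_le_rpow hε (d + 3) hx1
  have hexp : ε * ((d + 3 : ℕ) : ℝ) = 1 := by rw [hεdef]; push_cast; field_simp
  rw [hexp, Real.rpow_one] at h
  -- `(1+log x)^d (log x)^3 ≤ (1+log x)^{d+3} ≤ K x`
  have h3 : Real.log x ^ 3 ≤ (1 + Real.log x) ^ 3 := pow_le_pow_left₀ hlog0.le (by linarith) 3
  have hmain : (1 + Real.log x) ^ d * Real.log x ^ 3 ≤ (1 + ε⁻¹) ^ (d + 3) * x := by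
    calc (1 + Real.log x) ^ d * Real.log x ^ 3 ≤ (1 + Real.log x) ^ d * (1 + Real.log x) ^ 3 :=
          mul_le_mul_of_nonneg_left h3 (pow_nonneg (by linarith) d)
      _ = (1 + Real.log x) ^ (d + 3) := by rw [← pow_add]
      _ ≤ _ := h
  rw [inv_pow, ← div_eq_mul_inv, le_div_iff₀ (pow_pos hlog0 3)]
  exact hmain

/-- `1 + 2 log q ≤ 9 (1 + log q̂)` (`q = 4π² q̂²` and `log 2π ≤ 2`). -/
theorem one_add_two_log_le {q : ℕ} [NeZero q] (hq : 64 ≤ q) :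
    1 + 2 * Real.log (q : ℝ) ≤ 9 * (1 + Real.log (KMV2000.qhat q)) := by
  have hqh1 : 1 < KMV2000.qhat q := one_lt_qhat hq
  have hqh0 : 0 < KMV2000.qhat q := zero_lt_one.trans hqh1
  have hq0 : (0 : ℝ) < q := by exact_mod_cast lt_of_lt_of_le (by norm_num : 0 < 64) hq
  have hqe : (q : ℝ) = (2 * π * KMV2000.qhat q) ^ 2 := by
    unfold KMV2000.qhat
    rw [show 2 * π * (Real.sqrt q / (2 * π)) = Real.sqrt q by field_simp, Real.sq_sqrt hq0.le]
  have h2π : 0 < 2 * π := by positivity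
  have hlog : Real.log (q : ℝ) = 2 * (Real.log (2 * π) + Real.log (KMV2000.qhat q)) := by
    rw [hqe, Real.log_pow, Real.log_mul h2π.ne' hqh0.ne']
    push_cast; ring
  have hl2π : Real.log (2 * π) ≤ 2 := by
    rw [Real.log_le_iff_le_exp h2π]
    have h1 := Real.exp_one_gt_d9
    have hπ := Real.pi_lt_d2
    have he : Real.exp 2 = Real.exp 1 * Real.exp 1 := by rw [← Real.exp_add]; norm_num
    have hsq : (2.7182818283 : ℝ) * 2.7182818283 ≤ Real.exp 1 * Real.exp 1 :=
      mul_le_mul h1.le h1.le (by norm_num) (Real.exp_pos 1).le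
    rw [he]
    linarith
  have hlq : 0 ≤ Real.log (KMV2000.qhat q) := Real.log_nonneg hqh1.le
  rw [hlog]
  nlinarith

/-- `q ≥ 324 ⇒ q̂ = √q/2π ≥ e` (`18/(2π) = 9/π > 2.85 > e`). -/
theorem exp_one_le_qhat {q : ℕ} (hq : 324 ≤ q) : Real.exp 1 ≤ KMV2000.qhat q := by
  have hq' : (324 : ℝ) ≤ q := by exact_mod_cast hq
  have hs : (18 : ℝ) ≤ Real.sqrt q := by
    rw [show (18 : ℝ) = Real.sqrt (18 ^ 2) by rw [Real.sqrt_sq (by norm_num)]]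
    exact Real.sqrt_le_sqrt (by norm_num; linarith)
  have he : Real.exp 1 < 2.7182818286 := Real.exp_one_lt_d9
  have hπ : π < 3.15 := Real.pi_lt_d2
  unfold KMV2000.qhat
  rw [le_div_iff₀ (by positivity)]
  nlinarith [Real.pi_gt_three]

/-! ## §3. The identification at every `Q` -/

/-- **§3. THE IDENTIFICATION AT EVERY `Q`**: for all real polynomials `P, Q` and every cut `ρ` with `ρ(Δ') ≤ 8` on `(1, 3/2]`
there is `C` such that for all `Δ' ∈ (1, 3/2]` and all primes `q ≥ 324`,
`‖tail q ρ P Q Δ' − (−farLayers q ρ P Q Δ')‖ ≤ C · q̂ · (log q̂)⁻³`.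
[cite: KowalskiMichelVanderKam2000, (21)–(22) p. 12, Lemma 3.1 (10) p. 8; KowalskiMichel2000, §2.4.2 p. 312] -/
theorem tailNearFar_allQ (P Q : ℝ[X]) (ρ : ℝ → ℝ) (hρ : ∀ Δ' : ℝ, 1 < Δ' → Δ' ≤ 3 / 2 → ρ Δ' ≤ 8) :
    ∃ C : ℝ, ∀ Δ' : ℝ, 1 < Δ' → Δ' ≤ 3 / 2 → ∀ (q : ℕ) [NeZero q], q.Prime → 324 ≤ q →
      ‖tail q ρ P Q Δ' - -farLayers q ρ P Q Δ'‖ ≤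
        C * KMV2000.qhat q * (Real.log (KMV2000.qhat q))⁻¹ ^ 3 := by
  choose G hG0 hG using fun i j ↦ norm_gap₂_le P i j
  set d : ℕ := Q.natDegree with hd
  obtain ⟨K, hK0, hK⟩ := one_add_log_pow_le_mul_inv_log_cube (4 * d)
  set Gs : ℝ := ∑ i ∈ range (d + 1), ∑ j ∈ range (d + 1), |Q.coeff i| * |Q.coeff j| * G i j with hGs
  have hGs0 : 0 ≤ Gs := Finset.sum_nonneg fun i _ ↦ Finset.sum_nonneg fun j _ ↦
    mul_nonneg (mul_nonneg (abs_nonneg _) (abs_nonneg _)) (hG0 i j)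
  refine ⟨Gs * 9 ^ (2 * d) * K, fun Δ' h1 h32 q _ hq h324 ↦ ?_⟩
  have h64 : 64 ≤ q := le_trans (by norm_num) h324
  have h0 : 0 < Δ' := by linarith
  have hqh1 : 1 < KMV2000.qhat q := one_lt_qhat h64
  have hqh0 : 0 < KMV2000.qhat q := zero_lt_one.trans hqh1
  have hqe : Real.exp 1 ≤ KMV2000.qhat q := exp_one_le_qhat h324
  have hlog1 : 1 ≤ Real.log (KMV2000.qhat q) := by rwa [Real.le_log_iff_exp_le hqh0]
  have hlog0 : 0 < Real.log (KMV2000.qhat q) := by linarith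
  set x : ℝ := 1 + Real.log (KMV2000.qhat q) with hxdef
  have hx2 : 2 ≤ x := by rw [hxdef]; linarith
  -- the gap as the order sum
  have hE := tail_add_farLayers q ρ P Q Δ' (layerCount_le_pow_eight h64 (hρ Δ' h1 h32))
  have hE' : KMV2000.QhPQ q P Q (KMV2000.qhat q ^ Δ') - diagPart q P Q Δ' + ∑ r ∈ Icc 1 (q ^ 8), layer q P Q Δ' r =
      KMV2000.QhPQ q P Q (KMV2000.qhat q ^ Δ') - (diagPart q P Q Δ' - ∑ r ∈ Icc 1 (q ^ 8), layer q P Q Δ' r) := by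
    ring
  rw [sub_neg_eq_add, hE, hE', QhPQ_sub_explicit_eq_sum_orders hq P Q Δ' (q ^ 8)]
  -- per-term bound
  have hℓ : 0 ≤ (Real.log (KMV2000.qhat q))⁻¹ := inv_nonneg.mpr hlog0.le
  have hℓ1 : (Real.log (KMV2000.qhat q))⁻¹ ≤ 1 := inv_le_one_of_one_le₀ hlog1
  have hLij : ∀ i ∈ range (d + 1), ∀ j ∈ range (d + 1),
      ((1 + Real.log (KMV2000.qhat q)) * (1 + 2 * Real.log q)) ^ (i + j) ≤ 9 ^ (2 * d) * x ^ (4 * d) := by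
    intro i hi j hj
    have hi' : i ≤ d := Nat.lt_succ_iff.mp (Finset.mem_range.mp hi)
    have hj' : j ≤ d := Nat.lt_succ_iff.mp (Finset.mem_range.mp hj)
    have h9 := one_add_two_log_le (q := q) h64
    calc ((1 + Real.log (KMV2000.qhat q)) * (1 + 2 * Real.log q)) ^ (i + j)
        ≤ (x * (9 * x)) ^ (i + j) := by
          refine pow_le_pow_left₀ (by positivity) ?_ _
          rw [hxdef]
          exact mul_le_mul_of_nonneg_left h9 (by positivity)
      _ = (9 * x ^ 2) ^ (i + j) := by ring
      _ ≤ (9 * x ^ 2) ^ (2 * d) := pow_le_pow_right₀ (by nlinarith) (by omega)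
      _ = 9 ^ (2 * d) * x ^ (4 * d) := by rw [mul_pow, ← pow_mul]; ring_nf
  have hterm : ∀ i ∈ range (d + 1), ∀ j ∈ range (d + 1),
      ‖(Q.coeff i : ℂ) * (Q.coeff j : ℂ) * (((Real.log (KMV2000.qhat q))⁻¹ : ℝ) : ℂ) ^ (i + j) *
          (GL2Family.harmonicSum q 2 (fun f ↦ KMV2000.derivLambda q i f * KMV2000.derivLambda q j f *
              KMV2000.mollifierP q P (KMV2000.qhat q ^ Δ') f ^ 2) -
            (1 + (-1 : ℂ) ^ (i + j)) * (KMV2000.qhat q : ℂ) *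
              ∑ n₁ ∈ afeBox q, ∑ n₂ ∈ afeBox q,
                ((((n₁ : ℝ) * n₂) ^ (-(1 / 2 : ℝ)) : ℝ) : ℂ) * KMV2000.afeW (KMV2000.qhat q) i j n₁ n₂ *
                ∑ m₁ ∈ Icc 1 ⌊KMV2000.qhat q ^ Δ'⌋₊, ∑ m₂ ∈ Icc 1 ⌊KMV2000.qhat q ^ Δ'⌋₊,
                  (KMV2000.mollifierCoeff P (KMV2000.qhat q ^ Δ') m₁ : ℂ) *
                    (KMV2000.mollifierCoeff P (KMV2000.qhat q ^ Δ') m₂ : ℂ) *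
                  ∑ d₁ ∈ (Nat.gcd m₁ n₁).divisors, ∑ d₂ ∈ (Nat.gcd m₂ n₂).divisors,
                    (diagKernel (m₁ * n₁ / d₁ ^ 2) (m₂ * n₂ / d₂ ^ 2) -
                      ∑ r ∈ Icc 1 (q ^ 8), layerKernel q r (m₁ * n₁ / d₁ ^ 2) (m₂ * n₂ / d₂ ^ 2)))‖ ≤
        |Q.coeff i| * |Q.coeff j| * G i j * (9 ^ (2 * d) * x ^ (4 * d)) := by
    intro i hi j hj
    have hg := hG i j q hq h64 Δ' h0 h32
    rw [norm_mul, norm_mul, norm_mul, norm_pow, Complex.norm_real, Complex.norm_real, Complex.norm_real,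
      Real.norm_eq_abs, Real.norm_eq_abs, Real.norm_eq_abs, abs_of_nonneg hℓ]
    have hpow : (Real.log (KMV2000.qhat q))⁻¹ ^ (i + j) ≤ 1 := pow_le_one₀ hℓ hℓ1
    calc |Q.coeff i| * |Q.coeff j| * (Real.log (KMV2000.qhat q))⁻¹ ^ (i + j) * _
        ≤ |Q.coeff i| * |Q.coeff j| * 1 *
            (G i j * ((1 + Real.log (KMV2000.qhat q)) * (1 + 2 * Real.log q)) ^ (i + j)) := by
          gcongr
      _ ≤ |Q.coeff i| * |Q.coeff j| * 1 * (G i j * (9 ^ (2 * d) * x ^ (4 * d))) := by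
          gcongr
          · exact hG0 i j
          · exact hLij i hi j hj
      _ = _ := by ring
  have hx := hK (KMV2000.qhat q) hqe
  calc _ ≤ ∑ i ∈ range (d + 1), ∑ j ∈ range (d + 1), |Q.coeff i| * |Q.coeff j| * G i j * (9 ^ (2 * d) * x ^ (4 * d)) := by
        refine (norm_sum_le _ _).trans (Finset.sum_le_sum fun i hi ↦ ?_)
        exact (norm_sum_le _ _).trans (Finset.sum_le_sum fun j hj ↦ hterm i hi j hj)
    _ = Gs * 9 ^ (2 * d) * x ^ (4 * d) := by
        rw [hGs, Finset.sum_mul, Finset.sum_mul]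
        refine Finset.sum_congr rfl fun i _ ↦ ?_
        rw [Finset.sum_mul, Finset.sum_mul]
        refine Finset.sum_congr rfl fun j _ ↦ ?_
        ring
    _ ≤ Gs * 9 ^ (2 * d) * (K * KMV2000.qhat q * (Real.log (KMV2000.qhat q))⁻¹ ^ 3) := by
        rw [hxdef]; gcongr
    _ = Gs * 9 ^ (2 * d) * K * KMV2000.qhat q * (Real.log (KMV2000.qhat q))⁻¹ ^ 3 := by ring

/-! ## §4. The registered stub -/

/-- **STUB 6 of line «petersson_layers» v4 — `stub_identP : TailNearFar rhoP`, PROVED** (window `(1, 3/2]`, threshold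
`q ≥ 324`, constant from `tailNearFar_allQ`; the admissibility of `P`, the parity of `Q` and the genericity `q̂^{Δ'} ∉ ℕ` are not
used). The identification `TAIL(ρ_P) = −FAR(ρ_P) + O(q̂ log⁻³ q̂)`: AFE at two orders (`…TwoOrderAFE`) ∘ Hecke (10) ∘ Petersson
(11) (+ Weil for `r > q⁸`, decay of `W_{ij}` for `n > q²`).
[cite: KowalskiMichelVanderKam2000, (21)–(22) p. 12, Lemma 3.1 (10) p. 8; KowalskiMichel2000, §2.4.2 p. 312] -/
theorem stub_identP : TailNearFar rhoP := by
  refine ⟨3 / 2, by norm_num, fun P Q _ _ Δ' h1 h32 ↦ ?_⟩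
  obtain ⟨C, hC⟩ := tailNearFar_allQ P Q rhoP (fun Δ' h₁ h₂ ↦ rhoP_le_eight Δ' h₁ h₂)
  exact ⟨C, 324, fun q _ hq hq₀ _ ↦ hC Δ' h1 h32 q hq hq₀⟩

end Summit.Parity.GeneralizedHardyLittlewood.Theorems.MomentsBeyondDiagonal.TwoOrderAFE

end
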